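import Mathlib.Algebra.BigOperators.Group.Finset.Basic
import Literature.Computability.QuantumComplexity.IQPForrelation

/-!
# Crux `CubicForrelation.NearExactIsExact` (stmt-QuantumAdvantage-14043), stub `stub_invariantWeight`

Line `direct-sum-amplification`, stub IW (`stub_invariantWeight`, elementary orbit counting, folklore).
In the low-rank-dyadic-rigidity step the defect function `e` is invariant under translation by every
element of an xor-closed finset `V ∋ 0ⁿ` (a subgroup of `𝔽₂ⁿ`); this file proves that then `|V|` divides
`wt(e) = #{x : e x = true}`.

Proof (Lagrange-style orbit count, kept elementary because `Fin n → Bool` carries no additive-group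
instance for `⊕`): write `S = {x : e x}` and `O x = x ⊕ V = V.image (bxor x)`.  Translation `y ↦ x ⊕ y` is
injective (an involution), so `#(O x) = #V` (`iw_card_orbit`).  For `u ∈ V`, `(x ⊕ u) ⊕ V = x ⊕ V`
by closure of `V` under `⊕` and associativity (`iw_orbit_shift`).  Hence for `x ∈ S` the fiber of the
orbit map over `O x`, namely `{a ∈ S : O a = O x}`, is exactly `O x` (`iw_fiber_eq_orbit`: `⊇` by
invariance of `e` and `iw_orbit_shift`, `⊆` because `a = a ⊕ 0ⁿ ∈ O a`).  Summing the fiber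
cardinalities over the image of the orbit map (`Finset.card_eq_sum_card_image`) gives
`#S = #(orbits) · #V`.

Sources: orientation only (Lagrange's theorem for the translation action of a subgroup of `𝔽₂ⁿ`);
everything is proved from Mathlib's `Finset` API and the tree's `bxor` lemmas
(`Literature.Computability.QuantumComplexity.IQPForrelation`).
-/

set_option linter.dupNamespace false -- D-0017: single-problem summit ⇒ `QuantumAdvantage.QuantumAdvantage` by design

namespace Summit.QuantumAdvantage.QuantumAdvantage.Theorems.CubicForrelation.NearExactIsExact

open Finset
open Literature.Computability.QuantumComplexity
open Literature.Computability.QuantumComplexity.BuzetChailloux (bxor zeroVec bxor_zeroVec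
  bxor_bxor_cancel_left)

variable {n : ℕ}

/-- `(x ⊕ y) ⊕ z = x ⊕ (y ⊕ z)`. -/
theorem iw_bxor_assoc (x y z : Fin n → Bool) : bxor (bxor x y) z = bxor x (bxor y z) := by
  funext i; exact Bool.xor_assoc _ _ _

/-- Translation `y ↦ x ⊕ y` is injective (it is an involution). -/
theorem iw_bxor_injective (x : Fin n → Bool) : Function.Injective (bxor x) :=
  Function.Involutive.injective (bxor_bxor_cancel_left x)

/-- The orbit `x ⊕ V` has exactly `#V` elements. -/
theorem iw_card_orbit (V : Finset (Fin n → Bool)) (x : Fin n → Bool) :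
    (V.image (bxor x)).card = V.card :=
  card_image_of_injective V (iw_bxor_injective x)

/-- Orbits of an xor-closed `V` are translation stable: `(x ⊕ u) ⊕ V = x ⊕ V` for `u ∈ V`. -/
theorem iw_orbit_shift {V : Finset (Fin n → Bool)} (hV : ∀ x ∈ V, ∀ y ∈ V, bxor x y ∈ V)
    (x : Fin n → Bool) {u : Fin n → Bool} (hu : u ∈ V) :
    V.image (bxor (bxor x u)) = V.image (bxor x) := by
  ext y
  simp only [mem_image]
  constructor
  · rintro ⟨v, hv, rfl⟩
    exact ⟨bxor u v, hV u hu v hv, (iw_bxor_assoc x u v).symm⟩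
  · rintro ⟨w, hw, rfl⟩
    refine ⟨bxor u w, hV u hu w hw, ?_⟩
    rw [iw_bxor_assoc, bxor_bxor_cancel_left]

/-- For `x` in the support `S` of a `V`-invariant `e` (`0ⁿ ∈ V`, `V` xor-closed), the fiber of the orbit
map `a ↦ a ⊕ V` over `x ⊕ V` inside `S` is the orbit `x ⊕ V` itself. -/
theorem iw_fiber_eq_orbit (e : (Fin n → Bool) → Bool) {V : Finset (Fin n → Bool)} (h0 : zeroVec ∈ V)
    (hV : ∀ x ∈ V, ∀ y ∈ V, bxor x y ∈ V) (he : ∀ u ∈ V, ∀ x, e (bxor x u) = e x)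
    {x : Fin n → Bool} (hx : e x = true) :
    ((univ.filter fun a => e a = true).filter fun a => V.image (bxor a) = V.image (bxor x)) =
      V.image (bxor x) := by
  ext a
  simp only [mem_filter, mem_univ, true_and]
  constructor
  · rintro ⟨-, ha⟩
    rw [← ha]
    exact mem_image.2 ⟨zeroVec, h0, bxor_zeroVec a⟩
  · intro ha
    obtain ⟨u, hu, rfl⟩ := mem_image.1 ha
    exact ⟨(he u hu x).trans hx, iw_orbit_shift hV x hu⟩

/-- **stub_invariantWeight** (IW; elementary orbit counting). If `e` is invariant under every translation
by an element of an xor-closed `V ∋ 0ⁿ`, then `supp e` is a disjoint union of `V`-orbits, each of size `#V`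
(translation is injective), so `#V` divides `wt(e)`. -/
theorem stub_invariantWeight :
    ∀ (n : ℕ) (e : (Fin n → Bool) → Bool) (V : Finset (Fin n → Bool)), zeroVec ∈ V →
      (∀ x ∈ V, ∀ y ∈ V, bxor x y ∈ V) → (∀ u ∈ V, ∀ x, e (bxor x u) = e x) →
      V.card ∣ (univ.filter fun x => e x = true).card := by
  intro n e V h0 hV he
  set S : Finset (Fin n → Bool) := univ.filter fun x => e x = true with hS
  have hfib : ∀ b ∈ S.image (fun a => V.image (bxor a)),
      (S.filter fun a => V.image (bxor a) = b).card = V.card := by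
    intro b hb
    obtain ⟨x, hx, rfl⟩ := mem_image.1 hb
    have hx' : e x = true := (mem_filter.1 hx).2
    rw [hS, iw_fiber_eq_orbit e h0 hV he hx', iw_card_orbit]
  refine Dvd.intro_left (S.image (fun a => V.image (bxor a))).card ?_
  rw [card_eq_sum_card_image (fun a => V.image (bxor a)) S, sum_congr rfl hfib, sum_const,
    smul_eq_mul]

end Summit.QuantumAdvantage.QuantumAdvantage.Theorems.CubicForrelation.NearExactIsExact
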